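import Literature.NumberTheory.EllipticCurves.LeadingTerm
import Literature.NumberTheory.EllipticCurves.QuadraticTwist
import Literature.NumberTheory.DiophantineGeometry.LocalReduction
import HarnessLib

/-!
# Jetchev–Skinner–Wan 2017, Thm. 7.2.1 (iii) AS USED in §7.4.2 — the rank-`0` supersingular `p`-part
# of BSD for the QUADRATIC TWIST `E^{D″}` of a semistable curve, `(D″, Np) = 1` — typed as an
# explicitly labelled OPEN statement (the typed GAP `G_β` of the D2 / `JSW-ss` D-audit, Road J)

PURPOSE (programme BSD-LIT2PART T2e, cell `bsd-litref/jsw17`; reader 2's sheet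
`run/shared/lean/pub/bsd-litref/jsw17/sheets/D-AUDIT-jsw17-r2.md` §C.β / §F, typer filing). The
printed proof of Jetchev–Skinner–Wan, Camb. J. Math. 5 (2017) Thm. 1.2.1 (tree fact
`thm121_padicValRat_bsd_rank_one`, sibling file `RankOnePPart.lean`) at a SUPERSINGULAR `p` obtains
the UPPER bound (eq:shaupper) by "Appealing to part (ii) or (iii) of Theorem 7.2.1 (for `𝓔 = E^{D″}`)"
(arXiv:1512.06894 chunk p0031 L40), where `K″ = ℚ(√D″)` is chosen by (a)–(d) (p0031 L7–L18: primes of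
`N⁺` split, primes of `N⁻` inert, `p` split, `L(E^{D″},1) ≠ 0` — hence `(D″, Np) = 1` and NOTHING is
imposed on the reduction of `E` at the primes dividing `D″`). Thm. 7.2.1 (iii) (chunk p0028 L87–L92),
verbatim: "(iii) If `𝓔` is semistable or a twist of a semistable elliptic curve by a quadratic
character that is unramified at the primes dividing the conductor of the semistable curve and if `𝓔`
has supersingular reduction at `p` with `a_p(𝓔) = 0`, then
`ord_p(#Ш(𝓔/ℚ)[p^∞]) = ord_p(L(𝓔/ℚ,1)/(Ω_𝓔 · ∏_ℓ c_ℓ(𝓔)))`", under the standing hypotheses of Thm.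
7.2.1 (p0028 L73: "`𝓔/ℚ` … good or multiplicative reduction at the odd prime `p` … `ρ̄_{𝓔,p}`
irreducible. Suppose `L(𝓔,1) ≠ 0`"), with the source sentence (p0028 L70–L71) "that of part (iii) for
the supersingular case is a consequence of the proof of Kobayashi's main conjecture [wan:kobayashi]"
and Rem. 7.2.2 (p0029 L3–L8): "Part (iii) of the above theorem is slightly more general than the result
cited in [wan:kobayashi], where the elliptic curve is assumed to be semistable. However the same proof
extends to the case of the quadratic twist of a semistable curve." JSW do NOT prove (iii);
[wan:kobayashi] = arXiv:1411.6352 is "no longer intended for publication" (Burungale–Skinner–Tian–Wan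
arXiv:2409.01350v2 Rem. 1.4 (i)), and the superseding preprint states the twist clause in its
INTRODUCTION (Thms. 1.3/1.5, chunk p0004 L90–L91, L119) only for discriminants "coprime to `Np` and
divisible only by primes of ordinary reduction for `E`" — typed in the tree as
`Literature.NumberTheory.EllipticCurves.BurungaleSkinnerTianWan2024.thm15_twist_pPart_OPEN`
(`BurungaleSkinnerTianWan2024/SupersingularTwistPPartOPEN.lean`; the INTRO form, WITH the
ordinary-primes restriction, `r ≤ 1`; cell `b2b-bsdres`) — while its BODY (Part III Thm. 2.1 /
Cor. 2.2 / Thm. 2.5 / Thm. 1.24, chunks p0075 L18, L42, L115, p0074 L3) asks only "discriminant coprime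
to `Np`", proved by assertion (p0074 L14–L17: "this case is not explicitly covered by the results of
[W1, CLW], but essentially the same argument applies"); Part III Rem. 2.3 (ii) (p0075 L67–L69) records
that JSW's approach "relies on the `r = 0` case of Corollary 2.2". So the statement below has NO
refereed proof and NO in-cell verification (the `bsd-ssimc` verification of record covers Thm. 1.3
for `E` itself): reader 2's verdict GAP(line) for Road J. It is typed here so that the gap has a Lean
NAME — an OPEN hypothesis, `[claim: …, status: under-review]`, NEVER to be fed as a theorem; no
consumer in the tree uses it (the road of record for row C3 ∩ {`p ∣ a_p`} at `p ≥ 5` is Road K,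
`Summit.….Supersingular.X6.bsdp_of_BSTW13_OPEN_of_corA5_of_analyticRank_eq_one`, which consumes no
twist clause). Transcription = reader 2's staged `twistRankZeroSupersingular_TARGET`
(`jsw17/staging/bsd-litref-jsw17-r2/JSWTwistRankZeroSupersingularTarget.lean`, sha16 07a041b765b7f8b6),
moved into this paper's namespace with tree tags; shape = the tree's rank-`0` transcription bsd.S30
`Literature.NumberTheory.EllipticCurves.padicValRat_bsd_rank_zero` (torsion term kept; it vanishes
under irreducibility). RESTRICTED to what §7.4.2 needs: `(D″, Np) = 1` (every prime ramified in
`ℚ(√d)` is a GOOD prime of `E` different from `p`), which is narrower than (iii)'s "unramified at the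
primes dividing the conductor" (that allows `p ∣ D″`) — a specialisation.
-- TODO(general form): (iii) verbatim (twisting character merely unramified at the primes of `N_E`;
-- `p` of good or multiplicative reduction) once a refereed source proves it.
PARTITION: row D2 — 0 classes moved (types the Road-J gap; Road K is the booking road).

## References
* [JetchevSkinnerWan2017] Camb. J. Math. 5 (2017) 369–434 = arXiv:1512.06894: Thm. 7.2.1 (iii)
  (chunk p0028 L87–L92), Rem. 7.2.2 (p0029 L3–L8), §7.4.2 (p0031 L7–L18, L40).
* [BurungaleSkinnerTianWan2024] arXiv:2409.01350v2: Thm. 1.3/1.5 (p0004 L90–L91, L119), Rem. 1.4 (i);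
  Part III Thm. 1.24 (p0074 L3–L17), Thm. 2.1 / Cor. 2.2 / Rem. 2.3 (ii) / Thm. 2.5 (p0075).
* pub/bsd-litref/jsw17/sheets/D-AUDIT-jsw17-r2.md §C.β, §F (sha16 f83188b3df20ab5f);
  pub/bsd-ssimc/audit1-DAUDIT-1.md §B.2.
-/

noncomputable section

open scoped Classical NumberField

open WeierstrassCurve

namespace Literature.NumberTheory.EllipticCurves.JetchevSkinnerWan2017

/-- **OPEN STATEMENT (typed gap `G_β`; NO refereed proof) — Jetchev–Skinner–Wan 2017 Thm. 7.2.1 (iii)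
+ Rem. 7.2.2 as USED at §7.4.2 for `𝓔 = E^{D″}`; = the BODY twist clause of Burungale–Skinner–Tian–Wan
arXiv:2409.01350v2 Part III Cor. 2.2 (`r = 0`), preprint.** `W` a globally minimal model of a
SEMISTABLE `E/ℚ` (`W.IsSemistable (𝓞 ℚ)`); `W'` a globally minimal model of the quadratic twist `E^d`
(`C • W' = W.quadraticTwist d`), `d` a squarefree integer such that `ℚ(√d)` has discriminant coprime
to `N_E · p`: every prime `ℓ ∣ d` is a good prime of `E` with `ℓ ≠ p`, and if `d ≢ 1 (mod 4)` then `2`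
is a good prime of `E` and `p ≠ 2`; `p ≥ 3` a good prime of `E^d` with `a_p(E^d) = 0` (supersingular;
`a_p(E^d) = ±a_p(E)`); `E^d[p]` irreducible; `L(E^d,1) ≠ 0`; `Ш(E^d)` finite (Kato/Kolyvagin, carried
as in bsd.S30). CONCLUSION (rank-`0` `p`-part of BSD for `E^d`, print's
"`ord_p(#Ш(𝓔)[p^∞]) = ord_p(L(𝓔,1)/(Ω_𝓔 ∏_ℓ c_ℓ(𝓔)))`" in the bsd.S30 shape): `L(E^d,1)/Ω_{E^d} = q ∈ ℚ`
with `ord_p q = ord_p #Ш(E^d) + ord_p ∏_ℓ c_ℓ(E^d) − 2·ord_p #E^d(ℚ)_tors` (torsion term `= 0` under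
irreducibility). NEVER cite this `Prop` as a theorem; take it as an explicit hypothesis. Stated in
the refereed [JetchevSkinnerWan2017] Thm. 7.2.1 (iii) with proof by reference to the withdrawn
arXiv:1411.6352; claimed (body form) by the preprint [BurungaleSkinnerTianWan2024] III Cor. 2.2.
[claim: BurungaleSkinnerTianWan2024, status: under-review] -/
def thm721iii_twist_padicValRat_bsd_rank_zero_OPEN : Prop :=
  ∀ (W W' : WeierstrassCurve ℚ) [W.IsElliptic] [W.IsGloballyMinimal] [W'.IsElliptic]
    [W'.IsGloballyMinimal] (d : ℤ) (C : VariableChange ℚ) (_hC : C • W' = W.quadraticTwist (d : ℚ))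
    (_hd : Squarefree d) (p : ℕ) [Fact p.Prime] (_hp : 3 ≤ p)
    (_hsst : W.IsSemistable (𝓞 ℚ))
    (_hdN : ∀ (ℓ : ℕ) [Fact ℓ.Prime], (ℓ : ℤ) ∣ d → W.HasGoodReductionAtPrime ℓ ∧ ℓ ≠ p)
    (_hd2 : ¬ d ≡ 1 [ZMOD 4] → W.HasGoodReductionAtPrime 2 ∧ p ≠ 2)
    (_hgood : W'.HasGoodReductionAtPrime p) (_hap : W'.frobeniusTrace p = 0)
    (_hirr : W'.HasIrreducibleModPGaloisRep p) (_hL : W'.entireLFunction 1 ≠ 0)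
    (_hfin : Finite W'.sha),
    ∃ q : ℚ, W'.entireLFunction 1 / (W'.realPeriodRat : ℂ) = (q : ℂ) ∧
      padicValRat p q = (padicValNat p W'.shaOrder : ℤ) + padicValNat p W'.tamagawaProduct -
        2 * padicValNat p W'.torsionOrder

end Literature.NumberTheory.EllipticCurves.JetchevSkinnerWan2017

end
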